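import Mathlib.Algebra.Module.ZMod
import Mathlib.Analysis.SpecialFunctions.Log.Basic
import Literature.NumberTheory.EllipticCurves.BSDSelmerSmithTwoSelmerRankLaws
import Literature.NumberTheory.EllipticCurves.BSDSelmerSmithAssumption
import HarnessLib

/-!
# Smith, *The distribution of `ℓ^∞`-Selmer groups in degree `ℓ` twist families* I (§1.1) and II (§1):
# the `2^k`-Selmer rank laws in quadratic twist families (I Thm. 1.5, Rem. 1.3; II Prop. 1.3, Thm. 1.4)

A. Smith, part I = J. Amer. Math. Soc. **39** (2026), no. 1, 1–72 (doi:10.1090/jams/1062) =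
arXiv:2207.05674v2 [Smi22a]; part II = J. Amer. Math. Soc. **39** (2026), no. 2, 453–514
(doi:10.1090/jams/1063) = arXiv:2207.05143v2 [Smi22b]. Both parts are REFEREED; numbering and
wording below follow the arXiv v2 texts (the JAMS pdfs are not held: acq-10994).

The tree already has part I, Thm. 1.2 (`smith2022_selmerCorank_distribution`, with Assumption 1.1 =
`smi22aAssumption`) and, from A. Smith, arXiv:2503.17619, Notation 1.8/1.9, the `2`-Selmer rank
`selmerTorsionRank` (`k = 1`) and the alternating-matrix kernel law `probKerDimAlt n j = P^Alt(j | n)`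
(`BSDSelmerSmithTwoSelmerRankLaws`). This file adds the HIGHER `2^k`-Selmer ranks and the
printed laws for the whole sequence `(r_2(A^d), r_4(A^d), …)` ("behaves like a time-homogeneous
Markov chain"):

* `selmerTorsionRankPow p k W = r_{p^k}(E/K)`: "the maximal `r` so that there is some injection
  `(ℤ/2^kℤ)^r ↪ Sel^{2^∞} E^d ⊂ H¹(G_ℚ, E[2^∞])`" (arXiv:2503.17619, Notation 1.8, verbatim, as a
  supremum over `r`; [Smi22a] §1.1 defines `r_n(A/F)` as the maximal `r` with
  `(ℤ/nℤ)^r ↪ Sel^n(A/F)/im(A(F)_tors)`, the same integer for `n = 2^k` since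
  `Sel^{2^k}(A)/im A(F)[2^∞] ≅ Sel^{2^∞}(A)[2^k]` by the Kummer sequence of
  `0 → A[2^k] → A[2^∞] → A[2^∞] → 0`); `twistSelmerTorsionRankPow A k d = r_{2^k}(A^d)`.
  PROVED (`selmerTorsionRankPow_one`, via a private linear-algebra lemma): for `k = 1` this is the tree's `selmerTorsionRank`
  (`dim_{𝔽_p} Sel_{p^∞}[p]`), unconditionally (both sides are `0` when `Sel[p]` is infinite).
* [Smi22a] Def. 1.4's averaged limit `P^Alt(j | ∞) = lim_n ½ (P^Alt(j | 2n) + P^Alt(j | 2n+1))` and the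
  infinite product `∏_{k ≥ 2} P^Alt(r_{2^k} | r_{2^{k-1}})` are not given junk-valued names
  (`limUnder`/`tprod`): as in `smith2025_thm110` the statements quantify over the LIMITS `P₁`, `Pprod`
  of the printed sequences (hypotheses `Tendsto … (𝓝 P₁)`, `Tendsto … (𝓝 Pprod)`; both limits exist:
  [Smi22b] Case 2.13 prints the closed form of `P^Alt(j | ∞)`, and the partial products are
  eventually constant or tend to `0` because a nonincreasing sequence of naturals is eventually
  constant `= r` with `P^Alt(r | r) = 2^{-r(r-1)/2}`).
* `smith2026_twoPowerSelmerRanks_markov` = [Smi22a] **Thm. 1.5** (cases (1), (3) of Assumption 1.1;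
  proved in [Smi22b] §3.1, Examples 3.1–3.3, from [Smi22b] Thm. 2.14);
  `smith2026_selmerCorank_ge_two_effective` = [Smi22a] **Rem. 1.3** (the effective
  `exp(−c (log log log H)^{1/2})` bound for `r_{2^∞} ≥ 2`, asserted in print for all of
  Assumption 1.1; it is the error term of [Smi22b] Thm. 2.14);
  `IsFavoredTwist a b d` = [Smi22b] **Example 1.2** (favored `d` for `A : y² = x(x² + ax + b)`);
  `klagsbrunLemkeOliver_unfavored_twoSelmerRank_large` = [Smi22b] **Prop. 1.3** (= Klagsbrun–Lemke
  Oliver, Mathematika 62 (2016)); `smith2026_twoPowerSelmerRanks_markov_favored` = [Smi22b]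
  **Thm. 1.4** (the favored-twist law in case (2); proved in [Smi22b] §3.1, Example 3.4).

READING FLAG (recorded in the typing cell's faithfulness sheet): [Smi22b] Example 1.2 defines
"favored" for SQUAREFREE `d` ("among the odd prime divisors `p` of `d` …") while the counting
functions of Prop. 1.3 / Thm. 1.4 range over all `d ∈ ℤ^{≠0}` and Thm. 1.4 divides by `H` (the
count of favored nonzero `d` with `|d| ≤ H`); since `A^d` and favoredness (Def. 2.7: a property of
the quadratic character `χ_d`) depend only on `d (ℚ^×)²`, `IsFavoredTwist` reads "prime divisors
of `d`" as the primes dividing `d` to ODD order — literally the printed definition on squarefree `d`.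

Nothing is proved about the four facts; the API is definitional plus `selmerTorsionRankPow_one`.

## References

* [Smith2022SelmerTwistI] A. Smith, *The distribution of `ℓ^∞`-Selmer groups in degree `ℓ` twist
  families I*, J. Amer. Math. Soc. 39 (2026) 1–72 = arXiv:2207.05674v2: §1.1 (definition of
  `r_n(A/F)`, `r_{ℓ^∞}`), Assumption 1.1, Thm. 1.2, Rem. 1.3, Def. 1.4, Thm. 1.5, Rem. 1.6.
* [Smith2026SelmerTwistII] A. Smith, part II, J. Amer. Math. Soc. 39 (2026) 453–514 =
  arXiv:2207.05143v2: Example 1.2, Prop. 1.3, Thm. 1.4 ("Cf. [Smi1, Theorem 1.5]") and the paragraph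
  after it; Def. 2.7 (favored twists); Case 2.13 and Thm. 2.14; §3.1 Examples 3.1–3.4 ("Theorem 2.14
  yields [Smi1, Theorem 1.5] in case (1)" / "case (3)"; "So Theorem 1.4 follows from Theorem 2.14").
* [SmithGoldfeld2025] A. Smith, arXiv:2503.17619, Notation 1.8 (`r_{2^k}(E^d)`,
  `r_{2^∞} = lim_k r_{2^k}`), Notation 1.9 (`P^Alt`).
* [KlagsbrunLemkeOliver2016] Z. Klagsbrun, R. J. Lemke Oliver, *The distribution of `2`-Selmer ranks
  of quadratic twists of elliptic curves with partial two-torsion*, Mathematika 62 (2016) 67–78.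
-/

noncomputable section

open scoped Classical
open scoped AddSubgroup
open Filter Topology

universe u

namespace Literature.NumberTheory.EllipticCurves

open WeierstrassCurve

/-! ## The `p^k`-Selmer rank `r_{p^k}` (arXiv:2503.17619, Notation 1.8; [Smi22a] §1.1) -/

section Ranks

variable {K : Type u} [Field K] [NumberField K]

/-- **`r_{p^k}(E/K)`**, the `p^k`-Selmer rank (A. Smith, arXiv:2503.17619, Notation 1.8: "take
`r_{2^k}(E^d)` to be the `2^k`-Selmer rank of `E^d`; our convention is to define this as the maximal
`r` so that there is some injection `(ℤ/2^kℤ)^r ↪ Sel^{2^∞} E^d ⊂ H¹(G_ℚ, E[2^∞])`"), for any prime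
`p`, any `k` and a Weierstrass curve over a number field: the supremum of the `r : ℕ` admitting an
injective homomorphism `(ℤ/p^kℤ)^r →+ Sel_{p^∞}(E/K)` (`WeierstrassCurve.selmerGroupPInfty`). The
set of such `r` contains `0`; it is bounded (and the supremum a maximum) when `Sel_{p^∞}[p]` is
finite, and `sSup = 0` is the junk value otherwise. Part I ([Smi22a], §1.1) defines `r_n(A/F)` as the
maximal `r` with `(ℤ/nℤ)^r ↪ Sel^n(A/F)/im(A(F)_tors)`; for `n = p^k` this is the same number, since
the Kummer sequence of `0 → A[p^k] → A[p^∞] →(p^k) A[p^∞] → 0` identifies `Sel^{p^k}(A)/im A(F)[p^∞]`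
with `Sel_{p^∞}(A)[p^k]`, and injections from `(ℤ/p^kℤ)^r` land in the `p^k`-torsion.
[cite: SmithGoldfeld2025, Notation 1.8] [cite: Smith2022SelmerTwistI, §1.1] -/
def selmerTorsionRankPow (p k : ℕ) (W : WeierstrassCurve K) : ℕ :=
  sSup {r : ℕ | ∃ f : (Fin r → ZMod (p ^ k)) →+ ↥(selmerGroupPInfty W p), Function.Injective f}

omit [NumberField K] in
/-- Linear algebra behind `selmerTorsionRankPow_one`: for an additive group `G` and a prime `p`,
the supremum of the `r` with `(ℤ/pℤ)^r ↪ G` is `dim_{𝔽_p} G[p]` (both `0` if `G[p]` is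
infinite-dimensional). [folklore] -/
private theorem sSup_injective_zmod_eq_finrank_torsionBy (G : Type*) [AddCommGroup G] (p : ℕ)
    [Fact p.Prime] :
    letI : Module (ZMod p) (G[(p : ℤ)]) := AddSubgroup.torsionBy.zmodModule
    sSup {r : ℕ | ∃ f : (Fin r → ZMod p) →+ G, Function.Injective f} =
      Module.finrank (ZMod p) (G[(p : ℤ)]) := by
  letI : Module (ZMod p) (G[(p : ℤ)]) := AddSubgroup.torsionBy.zmodModule
  set S : Set ℕ := {r : ℕ | ∃ f : (Fin r → ZMod p) →+ G, Function.Injective f} with hS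
  -- every injection `(ℤ/p)^r →+ G` factors through `G[p]`, `ZMod p`-linearly
  have key : ∀ r ∈ S, ∃ g : (Fin r → ZMod p) →ₗ[ZMod p] G[(p : ℤ)], Function.Injective g := by
    rintro r ⟨f, hf⟩
    have hmem : ∀ x, f x ∈ G[(p : ℤ)] := fun x ↦ by
      rw [AddSubgroup.torsionBy.nsmul_iff, ← map_nsmul]
      have : (p : ℕ) • x = 0 := by
        ext i; simp [Pi.smul_apply]
      rw [this, map_zero]
    refine ⟨(f.codRestrict (G[(p : ℤ)]) hmem).toZModLinearMap p, ?_⟩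
    intro x y hxy
    apply hf
    have := congrArg Subtype.val hxy
    simpa using this
  by_cases hfin : Module.Finite (ZMod p) (G[(p : ℤ)])
  · -- finite case: the supremum is attained at `finrank`
    have hbound : ∀ r ∈ S, r ≤ Module.finrank (ZMod p) (G[(p : ℤ)]) := by
      intro r hr
      obtain ⟨g, hg⟩ := key r hr
      simpa using LinearMap.finrank_le_finrank_of_injective hg
    have hmemS : Module.finrank (ZMod p) (G[(p : ℤ)]) ∈ S := by
      set n := Module.finrank (ZMod p) (G[(p : ℤ)])
      let b := Module.finBasis (ZMod p) (G[(p : ℤ)])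
      refine ⟨((G[(p : ℤ)]).subtype).comp b.equivFun.symm.toLinearMap.toAddMonoidHom, ?_⟩
      exact Subtype.val_injective.comp b.equivFun.symm.injective
    apply le_antisymm
    · exact csSup_le ⟨_, hmemS⟩ hbound
    · exact le_csSup ⟨_, hbound⟩ hmemS
  · -- infinite case: both sides are `0`
    rw [Module.finrank_of_not_finite hfin]
    apply Nat.sSup_of_not_bddAbove
    rintro ⟨n, hn⟩
    -- an infinite-dimensional `𝔽_p`-vector space contains a copy of `(ℤ/p)^(n+1)`
    have hmem : n + 1 ∈ S := by
      let b := Module.Basis.ofVectorSpace (ZMod p) (G[(p : ℤ)])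
      have hι : Infinite (Module.Basis.ofVectorSpaceIndex (ZMod p) (G[(p : ℤ)])) := by
        by_contra hι
        rw [not_infinite_iff_finite] at hι
        exact hfin (Module.Finite.of_basis b)
      let e : Fin (n + 1) ↪ Module.Basis.ofVectorSpaceIndex (ZMod p) (G[(p : ℤ)]) :=
        Fin.valEmbedding.trans (Infinite.natEmbedding _)
      have hli : LinearIndependent (ZMod p) (b ∘ e) :=
        b.linearIndependent.comp e e.injective
      refine ⟨((G[(p : ℤ)]).subtype).comp
        (Fintype.linearCombination (ZMod p) (b ∘ e)).toAddMonoidHom, ?_⟩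
      exact Subtype.val_injective.comp hli.fintypeLinearCombination_injective
    exact absurd (hn hmem) (by omega)

/-- **`r_p = r_{p^1}`**: for `k = 1` Smith's "maximal `r` with `(ℤ/pℤ)^r ↪ Sel_{p^∞}`" is the
tree's `selmerTorsionRank p W = dim_{𝔽_p} Sel_{p^∞}(E/K)[p]` (arXiv:2503.17619, Notation 1.8 with
`k = 1`; `BSDSelmerSmithTwoSelmerRankLaws`). Unconditional: if `Sel[p]` were infinite both sides
are `0`. [cite: SmithGoldfeld2025, Notation 1.8] -/
theorem selmerTorsionRankPow_one (p : ℕ) [Fact p.Prime] (W : WeierstrassCurve K) :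
    selmerTorsionRankPow p 1 W = selmerTorsionRank p W := by
  rw [selmerTorsionRankPow, pow_one]
  exact sSup_injective_zmod_eq_finrank_torsionBy _ p

/-- `0` is always an admissible `r` (the zero map from the trivial group is injective), so the
set in `selmerTorsionRankPow` is nonempty. [cite: SmithGoldfeld2025, Notation 1.8] -/
theorem zero_mem_setOf_selmerTorsionRankPow (p k : ℕ) (W : WeierstrassCurve K) :
    0 ∈ {r : ℕ | ∃ f : (Fin r → ZMod (p ^ k)) →+ ↥(selmerGroupPInfty W p), Function.Injective f} :=
  ⟨0, fun x y _ ↦ Subsingleton.elim x y⟩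

end Ranks

/-- **`r_{2^k}(A^d)`** as a function of `d ∈ ℤ` ([Smi22a] Thm. 1.5, [Smi22b] Thm. 1.4; arXiv:2503.17619,
Notation 1.8): the `2^k`-Selmer rank of the quadratic twist `A^d = A.quadraticTwist d` (junk at
`d = 0`, excluded by every statement). [cite: SmithGoldfeld2025, Notation 1.8] -/
def twistSelmerTorsionRankPow (W : WeierstrassCurve ℚ) (k : ℕ) (d : ℤ) : ℕ :=
  selmerTorsionRankPow 2 k (W.quadraticTwist (d : ℚ))

/-- `r_{2^1}(A^d) = r_2(A^d)` (`twistSelmerTorsionRank`, Notation 1.8 with `k = 1`).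
[cite: SmithGoldfeld2025, Notation 1.8] -/
theorem twistSelmerTorsionRankPow_one (W : WeierstrassCurve ℚ) (d : ℤ) :
    twistSelmerTorsionRankPow W 1 d = twistSelmerTorsionRank W d :=
  selmerTorsionRankPow_one 2 _

/-! ## [Smi22a] Theorem 1.5: the `2^k`-Selmer ranks as a Markov chain (cases (1) and (3)) -/

/-- **Cases (1) or (3) of [Smi22a], Assumption 1.1**: "`A(ℚ)[2] = 0`", or "`A(ℚ)[2] ≅ (ℤ/2ℤ)²` and
`A` has no cyclic degree `4` isogeny defined over `ℚ`" — encoded exactly as the corresponding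
branches of the tree's `smi22aAssumption` (`#A(ℚ)[2] = ratTwoTorsionCard A`; isogenies and their
targets in the tree's sense). [cite: Smith2022SelmerTwistI, Assumption 1.1 (1), (3)] -/
def smi22aAssumptionOneOrThree (W : WeierstrassCurve ℚ) : Prop :=
  ratTwoTorsionCard W = 1 ∨
    (ratTwoTorsionCard W = 4 ∧
      ∀ (W'' : WeierstrassCurve ℚ) [W''.IsElliptic] (ψ : Isogeny W W''), ψ.IsCyclic → ψ.degree ≠ 4)

/-- Cases (1)/(3) imply Assumption 1.1. [cite: Smith2022SelmerTwistI, Assumption 1.1] -/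
theorem smi22aAssumptionOneOrThree.smi22aAssumption {W : WeierstrassCurve ℚ}
    (h : smi22aAssumptionOneOrThree W) : smi22aAssumption W := by
  rcases h with h1 | ⟨h4, h⟩
  · exact smi22aAssumption_of_ratTwoTorsionCard_eq_one h1
  · exact smi22aAssumption_of_ratTwoTorsionCard_eq_four h4 h

/-- **[Smi22a] = A. Smith, J. Amer. Math. Soc. 39 (2026) 1–72, Theorem 1.5 (the `2^k`-Selmer ranks
in the quadratic twist family form a Markov chain).** "Suppose `A/ℚ` is an elliptic curve that
fits into either case (1) or (3) of Assumption 1.1. Given any nonincreasing sequence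
`r_2 ≥ r_4 ≥ ⋯ ≥ r_{2^k} ≥ ⋯` of nonnegative integers, we have
`lim_{H → ∞} #{d ∈ ℤ^{≠0} : |d| < H and r_{2^k}(A^d) = r_{2^k} for all k ≥ 1} / (2H)
 = P^Alt(r_2 | ∞) · ∏_{k=2}^∞ P^Alt(r_{2^k} | r_{2^{k-1}})`."
Transcription: the sequence is `r : ℕ → ℕ` read at `k ≥ 1` (`r k = r_{2^k}`), nonincreasing there;
`r_{2^k}(A^d) = twistSelmerTorsionRankPow A k d`; `P^Alt(j | n) = probKerDimAlt n j`
(arXiv:2503.17619 Notation 1.9 = [Smi22a] Def. 1.4); `P^Alt(r_2 | ∞)` is Def. 1.4's averaged limit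
`lim_n ½ (P^Alt(r_2 | 2n) + P^Alt(r_2 | 2n+1))` — the statement quantifies over that limit `P₁`
(the first `Tendsto` hypothesis) and over the value `Pprod` of the infinite product, i.e. the limit of the partial
products `∏_{2 ≤ k < n}` (the second `Tendsto` hypothesis); `|d| < H` strict as printed, `H` along `ℕ`. REFEREED:
stated in part I, proved in part II (J. Amer. Math. Soc. 39 (2026) 453–514, §3.1: "Theorem 2.14
yields [Smi1, Theorem 1.5] in case (1)" (Examples 3.2–3.3) and "case (3)" (Example 3.1)).
[cite: Smith2022SelmerTwistI, Thm. 1.5 with Def. 1.4 and Assumption 1.1]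
[cite: Smith2026SelmerTwistII, §3.1, Examples 3.1–3.3 and Thm. 2.14] -/
def smith2026_twoPowerSelmerRanks_markov : Prop :=
  ∀ (A : WeierstrassCurve ℚ) [A.IsElliptic], smi22aAssumptionOneOrThree A →
    ∀ (r : ℕ → ℕ), (∀ k, 1 ≤ k → r (k + 1) ≤ r k) →
    ∀ (P₁ Pprod : ℝ),
      Tendsto (fun n : ℕ ↦ (probKerDimAlt (2 * n) (r 1) + probKerDimAlt (2 * n + 1) (r 1)) / 2)
        atTop (𝓝 P₁) →
      Tendsto (fun n : ℕ ↦ ∏ k ∈ Finset.Ico 2 n, probKerDimAlt (r (k - 1)) (r k)) atTop (𝓝 Pprod) →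
      Tendsto (fun H : ℕ ↦
        (Nat.card {d : ℤ | d ≠ 0 ∧ |d| < (H : ℤ) ∧
            ∀ k, 1 ≤ k → twistSelmerTorsionRankPow A k d = r k} : ℝ) / (2 * H))
        atTop (𝓝 (P₁ * Pprod))

/-- **[Smi22a], Remark 1.3 (effective zero-density of `r_{2^∞} ≥ 2`).** "Given `A/ℚ` satisfying
Assumption 1.1, there are positive constants `c, C > 0` so, for `H > C`, we have
`#{d ∈ ℤ : 0 < |d| ≤ H and r_{2^∞}(A^d/ℚ) ≥ 2} / (2H) ≤ exp(−c · (log log log H)^{1/2})`."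
Transcription: `r_{2^∞} = selmerCorankTwoInfty` (the `ℤ₂`-corank of `Sel_{2^∞}`, as in the tree's
Thm. 1.2 binder `smith2022_selmerCorank_distribution`); `H` real; `(·)^{1/2}` as `Real.sqrt`
(`log log log H > 0` once `H > e^e`, which `C` may be taken to exceed). Printed as a Remark in the
refereed part I ("A more precise version of the zero-density portion of this theorem is the
following"); it is the error term `exp(−c (log log log H)^{1/2})` of part II, Thm. 2.14, assembled
over the family as in the proofs of Thm. 1.2's three cases — the source prints no separate proof
of the Remark. [cite: Smith2022SelmerTwistI, Rem. 1.3] [cite: Smith2026SelmerTwistII, Thm. 2.14] -/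
def smith2026_selmerCorank_ge_two_effective : Prop :=
  ∀ (A : WeierstrassCurve ℚ) [A.IsElliptic], smi22aAssumption A →
    ∃ c C : ℝ, 0 < c ∧ 0 < C ∧ ∀ H : ℝ, C < H →
      (Nat.card {d : ℤ | 0 < |d| ∧ (|d| : ℝ) ≤ H ∧
          2 ≤ selmerCorankTwoInfty (A.quadraticTwist (d : ℚ))} : ℝ) / (2 * H) ≤
        Real.exp (-(c * Real.sqrt (Real.log (Real.log (Real.log H)))))

/-! ## [Smi22b] §1: favored twists (Example 1.2), Prop. 1.3, Thm. 1.4 -/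

/-- **Favored `d`** ([Smi22b] = A. Smith, J. Amer. Math. Soc. 39 (2026) 453–514, Example 1.2).
For rational `a, b` with `b`, `a² − 4b` nonzero, `A : y² = x(x² + ax + b)` (the model
`⟨0, a, 0, b, 0⟩`, as in the tree's `smithCaseII_of_not_isSquare`), `K = ℚ(√(a² − 4b))`,
`K₀ = ℚ(√b)`: "Given a squarefree integer `d`, we call `d` favored with respect to `A` if, among the
odd prime divisors `p` of `d` where `A` has good reduction, the number of primes at which `K₀/ℚ`
splits is no larger than the number of primes at which `K/ℚ` splits." Transcription: for such `p`
(odd, of good reduction for `A`, so unramified in `K = ℚ(A[2])` and `K₀ = ℚ(A₀[2])`), "`K₀` splits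
at `p`" ⟺ `b ∈ (ℚ_p^×)²` and "`K` splits at `p`" ⟺ `a² − 4b ∈ (ℚ_p^×)²`; good reduction is the
model-independent `HasGoodReductionAtPrime`; and — READING, see the module docstring — "prime
divisors of `d`" is taken as the primes dividing `d` to odd order (`Odd (v_p(d))`), which for
squarefree `d` is literally "`p ∣ d`" and makes favoredness a function of `d (ℚ^×)²` as in
[Smi22b] Def. 2.7. [cite: Smith2026SelmerTwistII, Example 1.2; Def. 2.7] -/
def IsFavoredTwist (a b : ℚ) (d : ℤ) : Prop :=
  {p : ℕ | p ≠ 2 ∧ Odd (padicValInt p d) ∧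
      ∃ hp : p.Prime, haveI := Fact.mk hp;
        (⟨0, a, 0, b, 0⟩ : WeierstrassCurve ℚ).HasGoodReductionAtPrime p ∧
          IsSquare ((b : ℚ) : ℚ_[p])}.ncard ≤
    {p : ℕ | p ≠ 2 ∧ Odd (padicValInt p d) ∧
      ∃ hp : p.Prime, haveI := Fact.mk hp;
        (⟨0, a, 0, b, 0⟩ : WeierstrassCurve ℚ).HasGoodReductionAtPrime p ∧
          IsSquare ((a ^ 2 - 4 * b : ℚ) : ℚ_[p])}.ncard

/-- **[Smi22b], Proposition 1.3** (= Z. Klagsbrun, R. J. Lemke Oliver, Mathematika 62 (2016)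
67–78, as restated by Smith): "Take `A, K`, and `K₀` as in Example 1.2, and choose `ε > 0`. We
assume `K` and `K₀` are distinct nontrivial extensions of `ℚ`. Then
`lim_{H → ∞} #{d ∈ ℤ^{≠0} : |d| ≤ H, d is not favored, and r_2(A^d) > (log log H)^{1/2 − ε}}
 / #{d ∈ ℤ^{≠0} : |d| ≤ H, d is not favored} = 1`." Transcription: `A = ⟨0, a, 0, b, 0⟩`;
"`K = ℚ(√(a² − 4b))`, `K₀ = ℚ(√b)` distinct nontrivial" = `a² − 4b`, `b`, `b(a² − 4b)` non-squares in
`ℚ` (as in the tree's `smithCaseII_of_not_isSquare`; this forces `b, a² − 4b ≠ 0`); `r_2(A^d)` =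
`twistSelmerTorsionRank A d` ("the `2^k`-Selmer rank of `A` as defined in [Smi1]", `k = 1`; see
`twistSelmerTorsionRankPow_one`); real power `(log log H)^{1/2 − ε}`; `H` along `ℕ`.
[cite: Smith2026SelmerTwistII, Prop. 1.3 with Example 1.2] [cite: KlagsbrunLemkeOliver2016] -/
def klagsbrunLemkeOliver_unfavored_twoSelmerRank_large : Prop :=
  ∀ (a b : ℚ), ¬ IsSquare (a ^ 2 - 4 * b) → ¬ IsSquare b → ¬ IsSquare (b * (a ^ 2 - 4 * b)) →
    ∀ ε : ℝ, 0 < ε →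
      Tendsto (fun H : ℕ ↦
        (Nat.card {d : ℤ | d ≠ 0 ∧ |d| ≤ (H : ℤ) ∧ ¬ IsFavoredTwist a b d ∧
            (Real.log (Real.log H)) ^ (1 / 2 - ε : ℝ) <
              twistSelmerTorsionRank (⟨0, a, 0, b, 0⟩ : WeierstrassCurve ℚ) d} : ℝ) /
          Nat.card {d : ℤ | d ≠ 0 ∧ |d| ≤ (H : ℤ) ∧ ¬ IsFavoredTwist a b d}) atTop (𝓝 1)

/-- **[Smi22b] = A. Smith, J. Amer. Math. Soc. 39 (2026) 453–514, Theorem 1.4** ("Cf. [Smi1,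
Theorem 1.5]"; the case of Assumption 1.1 (2) announced in [Smi22a] Rem. 1.6). "Take `A/ℚ`, `K`, and
`K₀` as in Example 1.2. We assume `K` and `K₀` are distinct nontrivial extensions of `ℚ`. Define
`P^Alt` as in [Smi1, Definition 1.4]. Then, given … any nonincreasing sequence `r_2 ≥ r_4 ≥ r_8 ≥ ⋯`
of nonnegative integers, we have
`lim_{H → ∞} #{d ∈ ℤ^{≠0} : |d| ≤ H, d is favored and r_{2^k}(A^d) = r_{2^k} for all k ≥ 1} / H
 = P^Alt(r_2 | ∞) · ∏_{k=2}^∞ P^Alt(r_{2^k} | r_{2^{k-1}})`."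
Transcription as in `smith2026_twoPowerSelmerRanks_markov` (limits `P₁`, `Pprod` as hypotheses) and
`klagsbrunLemkeOliver_unfavored_twoSelmerRank_large` (`A = ⟨0, a, 0, b, 0⟩`, the three non-square
conditions, `IsFavoredTwist`); denominator `H` as printed. REFEREED (proved in §3.1, Example 3.4:
"So Theorem 1.4 follows from Theorem 2.14"). By the paragraph after it, applying the theorem to `A`
and to `A₀` gives case (2) of [Smi22a] Thm. 1.2 (tree: `smith2022_selmerCorank_distribution`).
[cite: Smith2026SelmerTwistII, Thm. 1.4 with Example 1.2; §3.1 Example 3.4]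
[cite: Smith2022SelmerTwistI, Def. 1.4, Rem. 1.6] -/
def smith2026_twoPowerSelmerRanks_markov_favored : Prop :=
  ∀ (a b : ℚ), ¬ IsSquare (a ^ 2 - 4 * b) → ¬ IsSquare b → ¬ IsSquare (b * (a ^ 2 - 4 * b)) →
    ∀ (r : ℕ → ℕ), (∀ k, 1 ≤ k → r (k + 1) ≤ r k) →
    ∀ (P₁ Pprod : ℝ),
      Tendsto (fun n : ℕ ↦ (probKerDimAlt (2 * n) (r 1) + probKerDimAlt (2 * n + 1) (r 1)) / 2)
        atTop (𝓝 P₁) →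
      Tendsto (fun n : ℕ ↦ ∏ k ∈ Finset.Ico 2 n, probKerDimAlt (r (k - 1)) (r k)) atTop (𝓝 Pprod) →
      Tendsto (fun H : ℕ ↦
        (Nat.card {d : ℤ | d ≠ 0 ∧ |d| ≤ (H : ℤ) ∧ IsFavoredTwist a b d ∧
            ∀ k, 1 ≤ k →
              twistSelmerTorsionRankPow (⟨0, a, 0, b, 0⟩ : WeierstrassCurve ℚ) k d = r k} : ℝ) / H)
        atTop (𝓝 (P₁ * Pprod))

/-! ## Definitional API -/

/-- Unfolding `twistSelmerTorsionRankPow`. [cite: SmithGoldfeld2025, Notation 1.8] -/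
theorem twistSelmerTorsionRankPow_eq (W : WeierstrassCurve ℚ) (k : ℕ) (d : ℤ) :
    twistSelmerTorsionRankPow W k d = selmerTorsionRankPow 2 k (W.quadraticTwist (d : ℚ)) :=
  rfl

/-- The non-square hypotheses of Prop. 1.3 / Thm. 1.4 force `b ≠ 0` and `a² − 4b ≠ 0`, i.e.
`A : y² = x(x² + ax + b)` is an elliptic curve (Example 1.2's "such that `b` and `a² − 4b` are
nonzero"). [cite: Smith2026SelmerTwistII, Example 1.2] -/
theorem ne_zero_of_not_isSquare_twoTorsionModel {a b : ℚ} (h1 : ¬ IsSquare (a ^ 2 - 4 * b))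
    (h2 : ¬ IsSquare b) : b ≠ 0 ∧ a ^ 2 - 4 * b ≠ 0 :=
  ⟨fun h ↦ h2 ⟨0, by rw [h, mul_zero]⟩, fun h ↦ h1 ⟨0, by rw [h, mul_zero]⟩⟩

end Literature.NumberTheory.EllipticCurves

end
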